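import Summits.QuantumFields.YangMills.Theorems.SwapVirialDeficitSectorLaplaceEndGaussCoreSlabAssembly
import Summits.QuantumFields.YangMills.Theorems.SwapVirialDeficitSectorLaplaceEndGaussRefWeightMeasurable
import Summits.QuantumFields.YangMills.Theorems.SwapVirialDeficitSectorLaplaceEndCoreGaussCore
import Summits.QuantumFields.YangMills.Theorems.SwapVirialDeficitSectorLaplaceEndGaussConstants
import Summits.QuantumFields.YangMills.Theorems.SwapVirialDeficitSectorLaplaceSetIntegralOfLintegral
import HarnessLib

/-!
# THE PLUG OF `stub_end_gaussCore` (memo-ε), PART 3: ★★ the per-point chain (α)+(γ)+(δ) from the N2 socket to a real bound on `∫_{G♭} e^{−bF̂} dμ_B`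
# (skeleton ➎ of cell ym-idea-1; free-hands support of ⟨stmt-QuantumFields-24197⟩ `SwapVirialDeficit.SwapGluedStiffness`; w3 g67 memo-ε steps 1–2,
# LEAD g99 INTERFACE RULING (I1)–(I4) 2026-08-31 23:05Z)

For good `ε`, `0 < τ ≤ 1`, `0 < b`, a reference follower-Hessian family `AF` at `hubAt 0 1` ((I1): `hFs`, `hFyy`, `hamb`, `hAm` — conjuncts of ✓`exists_gnoFolHessian`)
and ONE instance of the hN2 socket of ✓`SigmaBall.endGauss_slab_le_of_N2` for `g := 𝟙_{G♭}·ofReal(e^{−bF̂(hubAt δ 1, ε, ·)})`, `s := √τ`,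
`D := ofReal((√det AF(gnoBase ·))⁻¹)` (I2), common rate `c = b/(6·55200L⁶)`, weight `A·D + T` with `A ≤ ofReal a`, `T ≤ ofReal tT`:
* `endGaussCore_subset_slab` (`G♭ ⊆ {|δ| < √τ}`, ✓`endSlab_abs_le`);
* ★★ `setIntegral_endGaussCore_le_of_socket`:
  `∫_{G♭} e^{−bF̂} dμ_B ≤ K(c)·(a·(e·Kσ + √τ)·(C_F(8/r)·Shell(r)) + tT·(36(√τ)^{1/3} + π²√τ))` for any shell radius `0 < r ≤ 1` with `122689728·r·L⁴ ≤ μ_F/2`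
  (✓`endGauss_slab_le_of_N2` with `hD` := ✓`D_ball_const`, `hDm` := ✓`measurable_D_ref`, `g` measurable by ✓`measurable_indicator_ofReal_exp` ∘ ✓`measurable_bDeficit`;
  then ✓`endGauss_shell_ge_D` and the Bochner conversion ✓`setIntegral_le_of_lintegral_indicator_le`).
The socket shape is LEAD g99's ✓`endGauss_N2_of_params` conclusion (HOME `fcl-p3-g49-EndGaussPlugSocket.lean`, byte-for-byte).

HONEST LABEL: bookkeeping toward the plug of `stub_end_gaussCore`; until (P) (w3 g68 ✓`endGauss_params` / LEAD ✓`endGauss_N2_of_params`) and the plug land and the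
skeleton is flipped, `stub_end_gaussCore` is OPEN; `stub_core_tip`, ⟨24197⟩ ∕ ⟨24194⟩ OPEN; item of record ⟨24085⟩ `SubOctaveBounded` aside ∕ untouched; the Yang–Mills
mass gap is NOT proved; no summit is proved by a line.  THEOREMS ONLY (0 `def`, 0 `sorry`), standard axioms, no instances beyond the series' local `ℍ` ones.
Seat ym-line-fcl-p3 g49 (cell ym-idea-1, free hands = ➎ assembler), `--supports stmt-QuantumFields-24197`.  References: [cite: Luscher1983, §2]; [folklore].
-/

set_option autoImplicit false
set_option synthInstance.maxSize 1024

noncomputable section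

open MeasureTheory Quaternion Set Module
open scoped Quaternion BigOperators ENNReal InnerProductSpace
open Literature.MathematicalPhysics.QuantumLattice
open Literature.MathematicalPhysics.QuantumFieldTheory hiding SU2
open Summit.QuantumFields.YangMills.Theorems.SwapTwistDeficit.ToronLog

namespace Summit.QuantumFields.YangMills.Theorems.SwapVirialDeficit.SectorLaplace

open Summit.QuantumFields.YangMills.Theorems.FemtoTransferGap
open Summit.QuantumFields.YangMills.Theorems.FemtoTransferGap.TT
open Summit.QuantumFields.YangMills.Theorems.VirialFluxGap.RingDeficit
open Summit.QuantumFields.YangMills.Theorems.SwapVirialDeficit.SwapRing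
open Summit.QuantumFields.YangMills.Theorems.SwapVirialDeficit.BlowUpRing
open Summit.QuantumFields.YangMills.Theorems.SwapVirialDeficit.Gnomonic (gnomonicWeight normSq3)

variable {L : ℕ} [NeZero L]

omit [NeZero L] in
/-- `G♭ τ ⊆ {|δ| < √τ}` for `0 < τ` (✓`endSlab_abs_le`: `|δ| ≤ (2/3)√τ`). [folklore] -/
theorem endGaussCore_subset_slab {τ : ℝ} (hτ : 0 < τ) :
    ({p : ℝ × GnoCoord L | 4 * p.1 ^ 2 / (1 + p.1 ^ 2) ^ 2 < τ ∧ τ ≤ (1 + p.1 ^ 2)⁻¹} \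
          ({p : ℝ × GnoCoord L | 4 * p.1 ^ 2 / (1 + p.1 ^ 2) ^ 2 < τ ∧ τ ≤ (1 + p.1 ^ 2)⁻¹ ∧ |p.1| < τ * Real.sqrt (1 + p.1 ^ 2)} ∩
            {p : ℝ × GnoCoord L | τ ≤ Real.sqrt (p.2.1.1 1 ^ 2 + p.2.1.1 2 ^ 2)} ∩
            {p : ℝ × GnoCoord L | |p.2.1.1 0| ≤ 1 * Real.sqrt (1 + p.2.1.1 1 ^ 2 + p.2.1.1 2 ^ 2)}) ∩
        {p : ℝ × GnoCoord L | p.2.1.1 1 ^ 2 + p.2.1.1 2 ^ 2 ≤ 1 + p.2.1.1 0 ^ 2}) ⊆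
      {p : ℝ × GnoCoord L | p.1 ∈ Ioo (-Real.sqrt τ) (Real.sqrt τ)} := by
  intro p hp
  have hw := hp.1.1
  have h := endSlab_abs_le hw.1 hw.2
  have hs : 0 < Real.sqrt τ := Real.sqrt_pos.2 hτ
  have hlt : |p.1| < Real.sqrt τ := lt_of_le_of_lt h (by linarith)
  exact ⟨by linarith [neg_abs_le p.1, hlt], lt_of_le_of_lt (le_abs_self _) hlt⟩

/-- ★★ **THE PER-POINT CHAIN (α)+(γ)+(δ) of memo-ε**: for good `ε`, `0 < τ ≤ 1`, `0 < b`, a reference family `AF` (I1) and an instance of the N2 socket with weight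
`A·D_ref + T`, `A ≤ ofReal a`, `T ≤ ofReal tT` (`0 ≤ a, tT`): the Bochner integral over the Gaussian core obeys
`∫_{G♭} e^{−bF̂} dμ_B ≤ K(c)·(a·(e·Kσ + √τ)·(C_F·(8/r)·Shell(r)) + tT·(36 τ^{1/6…}))` with the shell radius `r` free in `(0,1]`, `122689728·r·L⁴ ≤ μ_F/2`. [folklore] -/
theorem setIntegral_endGaussCore_le_of_socket {ε : GnoSign L} (hε : GoodSign ε) {τ : ℝ} (hτ : 0 < τ) (hτ1 : τ ≤ 1) {b : ℝ} (hb : 0 < b)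
    {AF : GnoCoord L → GnoFol L →ₗ[ℝ] GnoFol L} (hFs : ∀ η, (AF η).IsSymmetric)
    (hFyy : ∀ η (y : GnoFol L), ⟪AF η y, y⟫_ℝ =
      iteratedFDeriv ℝ 2 (fun y' : GnoFol L => gnoDeficit z₀ (fun _ => 1) (hubAt 0 1) ε (η + gnoFolEmb y')) 0 (fun _ => y))
    (hamb : ∀ η (y : GnoFol L), ⟪AF η y, y⟫_ℝ = iteratedFDeriv ℝ 2 (gnoDeficit z₀ (fun _ => 1) (hubAt 0 1) ε) η (fun _ => gnoFolEmb y))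
    (hAm : Measurable fun q : GnoCoord L × GnoFol L => ⟪AF q.1 q.2, q.2⟫_ℝ)
    {r : ℝ} (hr0 : 0 < r) (hr1 : r ≤ 1) (hr : 122689728 * r * (L : ℝ) ^ 4 ≤ (2304 * (L : ℝ) ^ 6 * (Fintype.card (Fol L) : ℝ))⁻¹ / 2)
    {A T : ℝ≥0∞} {a tT : ℝ} (ha : 0 ≤ a) (htT : 0 ≤ tT) (hA : A ≤ ENNReal.ofReal a) (hT : T ≤ ENNReal.ofReal tT)
    (hsock : ∀ (u : ℝ × ℝ) (t : Fin 3 → ℝ) (v : Fin 2 → ℝ) (z : Fin 3 → ℝ), t 0 ∈ Ioo (-Real.sqrt τ) (Real.sqrt τ) →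
          ∫⁻ F : Fol L → Fin 3 → ℝ,
              ENNReal.ofReal (((1 + (t 0) ^ 2)⁻¹) ^ 2 * gnoDensity ((((![t 1, u.1, u.2] : Fin 3 → ℝ), (![t 2, v 0, v 1] : Fin 3 → ℝ)), (z, F)) : GnoCoord L)) *
                ({p : ℝ × GnoCoord L | 4 * p.1 ^ 2 / (1 + p.1 ^ 2) ^ 2 < τ ∧ τ ≤ (1 + p.1 ^ 2)⁻¹} \
                      ({p : ℝ × GnoCoord L | 4 * p.1 ^ 2 / (1 + p.1 ^ 2) ^ 2 < τ ∧ τ ≤ (1 + p.1 ^ 2)⁻¹ ∧ |p.1| < τ * Real.sqrt (1 + p.1 ^ 2)} ∩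
                        {p : ℝ × GnoCoord L | τ ≤ Real.sqrt (p.2.1.1 1 ^ 2 + p.2.1.1 2 ^ 2)} ∩
                        {p : ℝ × GnoCoord L | |p.2.1.1 0| ≤ 1 * Real.sqrt (1 + p.2.1.1 1 ^ 2 + p.2.1.1 2 ^ 2)}) ∩
                    {p : ℝ × GnoCoord L | p.2.1.1 1 ^ 2 + p.2.1.1 2 ^ 2 ≤ 1 + p.2.1.1 0 ^ 2}).indicator
                  (fun q : ℝ × GnoCoord L => ENNReal.ofReal (Real.exp (-(b * gnoDeficit z₀ (fun _ => 1) (hubAt q.1 1) ε q.2))))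
                  (t 0, ((((![t 1, u.1, u.2] : Fin 3 → ℝ), (![t 2, v 0, v 1] : Fin 3 → ℝ)), (z, F)) : GnoCoord L)) ≤
            (A * ENNReal.ofReal ((Real.sqrt (LinearMap.det (AF (gnoBase (t 1) (t 2)))))⁻¹) + T) *
              ENNReal.ofReal (((1 + t 1 ^ 2 + (u.1 ^ 2 + u.2 ^ 2)) ^ 2)⁻¹ * Real.exp (-(b / (6 * (55200 * (L : ℝ) ^ 6)) *
                (16 * (t 0) ^ 2 / (1 + (t 0) ^ 2) + 8 * (t 1) ^ 2 / ((1 + (t 1) ^ 2) * (1 + (t 0) ^ 2)) + 4 * (t 2) ^ 2 / (1 + (t 2) ^ 2)) *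
                (u.1 ^ 2 + u.2 ^ 2) / (1 + t 1 ^ 2 + (u.1 ^ 2 + u.2 ^ 2))))) *
              ENNReal.ofReal (((1 + t 2 ^ 2 + (v 0 ^ 2 + v 1 ^ 2)) ^ 2)⁻¹ *
                Real.exp (-(b / (6 * (55200 * (L : ℝ) ^ 6)) * (v 0 ^ 2 + v 1 ^ 2) / (1 + t 2 ^ 2 + (v 0 ^ 2 + v 1 ^ 2))))) *
              ENNReal.ofReal (gnomonicWeight z * Real.exp (-(b / (6 * (55200 * (L : ℝ) ^ 6)) * normSq3 z / (1 + normSq3 z))))) :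
    ∫ p in {p : ℝ × GnoCoord L | 4 * p.1 ^ 2 / (1 + p.1 ^ 2) ^ 2 < τ ∧ τ ≤ (1 + p.1 ^ 2)⁻¹} \
            ({p : ℝ × GnoCoord L | 4 * p.1 ^ 2 / (1 + p.1 ^ 2) ^ 2 < τ ∧ τ ≤ (1 + p.1 ^ 2)⁻¹ ∧ |p.1| < τ * Real.sqrt (1 + p.1 ^ 2)} ∩
              {p : ℝ × GnoCoord L | τ ≤ Real.sqrt (p.2.1.1 1 ^ 2 + p.2.1.1 2 ^ 2)} ∩
              {p : ℝ × GnoCoord L | |p.2.1.1 0| ≤ 1 * Real.sqrt (1 + p.2.1.1 1 ^ 2 + p.2.1.1 2 ^ 2)}) ∩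
          {p : ℝ × GnoCoord L | p.2.1.1 1 ^ 2 + p.2.1.1 2 ^ 2 ≤ 1 + p.2.1.1 0 ^ 2},
        Real.exp (-(b * gnoDeficit z₀ (fun _ => 1) (hubAt p.1 1) ε p.2))
        ∂((volume : Measure (ℝ × GnoCoord L)).withDensity fun p => ENNReal.ofReal (((1 + p.1 ^ 2)⁻¹) ^ 2 * gnoDensity p.2)) ≤
      (Real.pi ^ 2 / (b / (6 * (55200 * (L : ℝ) ^ 6))) * (Real.pi ^ 2 / (b / (6 * (55200 * (L : ℝ) ^ 6)))) *
          (2 * (∫ w : EuclideanSpace ℝ (Fin 3), ((1 + ‖w‖ ^ 2) ^ 2)⁻¹) / ((1 + b / (6 * (55200 * (L : ℝ) ^ 6))) * Real.sqrt (1 + b / (6 * (55200 * (L : ℝ) ^ 6)))))) *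
        (a * (Real.exp 1 * (900 * (Real.sqrt τ) ^ (1 / 3 : ℝ) *
              (2 * ((2304 * (L : ℝ) ^ 6 * (Fintype.card (Fol L) : ℝ))⁻¹ / (3 * (Fintype.card (Fol L) : ℝ) * 44712000 * (L : ℝ) ^ 4))) ^ (1 / 3 : ℝ) *
              (2 * ((2304 * (L : ℝ) ^ 6 * (Fintype.card (Fol L) : ℝ))⁻¹ / (3 * (Fintype.card (Fol L) : ℝ) * 44712000 * (L : ℝ) ^ 4))) ^ (1 / 3 : ℝ) *
              ((2 * ((2304 * (L : ℝ) ^ 6 * (Fintype.card (Fol L) : ℝ))⁻¹ / (3 * (Fintype.card (Fol L) : ℝ) * 44712000 * (L : ℝ) ^ 4))) *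
                (2 * ((2304 * (L : ℝ) ^ 6 * (Fintype.card (Fol L) : ℝ))⁻¹ / (3 * (Fintype.card (Fol L) : ℝ) * 44712000 * (L : ℝ) ^ 4))))⁻¹) + Real.sqrt τ) *
            ((((1 + (finrank ℝ (GnoFol L) : ℝ)) * (20400 * (L : ℝ) ^ 4)) ^ (7 / 2 : ℝ) * Real.exp (1 / 2 : ℝ) *
                Real.exp ((3 * (Fintype.card (Fol L) : ℝ)) * (122689728 * r * (L : ℝ) ^ 4) / (2304 * (L : ℝ) ^ 6 * (Fintype.card (Fol L) : ℝ))⁻¹)) * (8 / r) *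
              ∫ δ' in Icc (r / 2) r, ((1 + δ' ^ 2)⁻¹) ^ 2 * ∫ p : ℝ × ℝ, mbDensity (L := L) (hubAt δ' 1) ε p) +
          tT * (36 * (Real.sqrt τ) ^ (1 / 3 : ℝ) + Real.pi ^ 2 * Real.sqrt τ)) := by
  -- names
  set G : Set (ℝ × GnoCoord L) := {p : ℝ × GnoCoord L | 4 * p.1 ^ 2 / (1 + p.1 ^ 2) ^ 2 < τ ∧ τ ≤ (1 + p.1 ^ 2)⁻¹} \
            ({p : ℝ × GnoCoord L | 4 * p.1 ^ 2 / (1 + p.1 ^ 2) ^ 2 < τ ∧ τ ≤ (1 + p.1 ^ 2)⁻¹ ∧ |p.1| < τ * Real.sqrt (1 + p.1 ^ 2)} ∩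
              {p : ℝ × GnoCoord L | τ ≤ Real.sqrt (p.2.1.1 1 ^ 2 + p.2.1.1 2 ^ 2)} ∩
              {p : ℝ × GnoCoord L | |p.2.1.1 0| ≤ 1 * Real.sqrt (1 + p.2.1.1 1 ^ 2 + p.2.1.1 2 ^ 2)}) ∩
          {p : ℝ × GnoCoord L | p.2.1.1 1 ^ 2 + p.2.1.1 2 ^ 2 ≤ 1 + p.2.1.1 0 ^ 2} with hGdef
  have hGm : MeasurableSet G := by rw [hGdef]; exact measurableSet_endGaussCore τ 1
  have hGS : G ⊆ {p : ℝ × GnoCoord L | p.1 ∈ Ioo (-Real.sqrt τ) (Real.sqrt τ)} := by rw [hGdef]; exact endGaussCore_subset_slab hτ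
  set μB : Measure (ℝ × GnoCoord L) := (volume : Measure (ℝ × GnoCoord L)).withDensity fun p => ENNReal.ofReal (((1 + p.1 ^ 2)⁻¹) ^ 2 * gnoDensity p.2)
    with hμB
  set Fh : ℝ × GnoCoord L → ℝ := fun q => gnoDeficit z₀ (fun _ => 1) (hubAt q.1 1) ε q.2 with hFh
  have hFhm : Measurable Fh := measurable_bDeficit z₀ (fun _ => 1) ε
  set g : ℝ × GnoCoord L → ℝ≥0∞ := G.indicator fun q => ENNReal.ofReal (Real.exp (-(b * Fh q))) with hgdef
  have hgm : Measurable g := SigmaBall.measurable_indicator_ofReal_exp hGm hFhm b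
  -- the reference weight (I2) and its ball-constancy (I4)
  set D : ℝ × ℝ → ℝ≥0∞ := fun p => ENNReal.ofReal ((Real.sqrt (LinearMap.det (AF (gnoBase p.1 p.2))))⁻¹) with hDdef
  have hDm : Measurable D := measurable_D_ref hFs hAm
  set ρ : ℝ := (2304 * (L : ℝ) ^ 6 * (Fintype.card (Fol L) : ℝ))⁻¹ / (3 * (Fintype.card (Fol L) : ℝ) * 44712000 * (L : ℝ) ^ 4) with hρ
  have hL : (0 : ℝ) < L := by exact_mod_cast NeZero.pos L
  have hL1 : (1 : ℝ) ≤ L := by exact_mod_cast NeZero.one_le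
  have hc1 : (1 : ℝ) ≤ Fintype.card (Fol L) := by exact_mod_cast one_le_card_fol (L := L)
  obtain ⟨hμ0, hμle⟩ := folMu_pos_le (L := L)
  have hρ0 : 0 < ρ := by rw [hρ]; positivity
  have hρ1 : ρ ≤ 1 := by
    rw [hρ, div_le_one (by positivity)]
    have hL4 : (1 : ℝ) ≤ (L : ℝ) ^ 4 := one_le_pow₀ hL1
    nlinarith
  have hD : ∀ p p' : ℝ × ℝ, dist p p' < ρ → D p ≤ ENNReal.ofReal (Real.exp 1) * D p' := fun p p' hd => D_ball_const hε hFs hFyy hamb hd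
  -- names of the real constants
  set s : ℝ := Real.sqrt τ with hsdef
  have hs0 : 0 < s := Real.sqrt_pos.2 hτ
  have hs1 : s ≤ 1 := by rw [hsdef, ← Real.sqrt_one]; exact Real.sqrt_le_sqrt hτ1
  set c : ℝ := b / (6 * (55200 * (L : ℝ) ^ 6)) with hcdef
  have hc : 0 < c := by rw [hcdef]; positivity
  -- (γ) and (δ), before naming the constants (the later `set`s rewrite them)
  have hγ := SigmaBall.endGauss_slab_le_of_N2 (L := L) hs0 hs1 hρ0 hρ1 hc hc hc g hgm D hDm hD (A := A) (T := T) (fun u t v z ht => by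
    have h := hsock u t v z ht
    simpa only [hgdef, hDdef, hFh] using h)
  have hDW : ∫⁻ p : ℝ × ℝ, D p * ENNReal.ofReal ((1 + p.1 ^ 2)⁻¹ * (1 + p.2 ^ 2)⁻¹) ≤ _ :=
    endGauss_shell_ge_D (L := L) hε hFs hFyy hamb hr0 hr1 hr
  set Kσ : ℝ := 900 * s ^ (1 / 3 : ℝ) * (2 * ρ) ^ (1 / 3 : ℝ) * (2 * ρ) ^ (1 / 3 : ℝ) * ((2 * ρ) * (2 * ρ))⁻¹ with hKσ
  set Sg : ℝ := 36 * s ^ (1 / 3 : ℝ) + Real.pi ^ 2 * s with hSg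
  set C3 : ℝ := ∫ w : EuclideanSpace ℝ (Fin 3), ((1 + ‖w‖ ^ 2) ^ 2)⁻¹ with hC3def
  set Kc : ℝ := Real.pi ^ 2 / c * (Real.pi ^ 2 / c) * (2 * C3 / ((1 + c) * Real.sqrt (1 + c))) with hKc
  set CF : ℝ := (((1 + (finrank ℝ (GnoFol L) : ℝ)) * (20400 * (L : ℝ) ^ 4)) ^ (7 / 2 : ℝ) * Real.exp (1 / 2 : ℝ) *
      Real.exp ((3 * (Fintype.card (Fol L) : ℝ)) * (122689728 * r * (L : ℝ) ^ 4) / (2304 * (L : ℝ) ^ 6 * (Fintype.card (Fol L) : ℝ))⁻¹)) * (8 / r) with hCF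
  set Shell : ℝ := ∫ δ' in Icc (r / 2) r, ((1 + δ' ^ 2)⁻¹) ^ 2 * ∫ p : ℝ × ℝ, mbDensity (L := L) (hubAt δ' 1) ε p with hShell
  have hC3 : 0 ≤ C3 := integral_nonneg fun w => by positivity
  have hKc0 : 0 ≤ Kc := by rw [hKc]; positivity
  have h2ρ : 0 ≤ 2 * ρ := by linarith
  have hKσ0 : 0 ≤ Kσ := by
    rw [hKσ]
    exact mul_nonneg (mul_nonneg (mul_nonneg (mul_nonneg (by norm_num) (Real.rpow_nonneg hs0.le _)) (Real.rpow_nonneg h2ρ _))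
      (Real.rpow_nonneg h2ρ _)) (inv_nonneg.2 (mul_nonneg h2ρ h2ρ))
  have hSg0 : 0 ≤ Sg := by rw [hSg]; exact add_nonneg (mul_nonneg (by norm_num) (Real.rpow_nonneg hs0.le _)) (mul_nonneg (sq_nonneg _) hs0.le)
  have hCF0 : 0 ≤ CF := by
    rw [hCF]
    exact mul_nonneg (mul_nonneg (mul_nonneg (Real.rpow_nonneg (by positivity) _) (Real.exp_pos _).le) (Real.exp_pos _).le) (by positivity)
  have hShell0 : 0 ≤ Shell :=
    setIntegral_nonneg measurableSet_Icc fun δ' _ => mul_nonneg (by positivity) (integral_nonneg fun p => mbDensity_nonneg _ ε p)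
  have hM0 : 0 ≤ Real.exp 1 * Kσ + s := add_nonneg (mul_nonneg (Real.exp_pos 1).le hKσ0) hs0.le
  have hP0 : 0 ≤ a * (Real.exp 1 * Kσ + s) * (CF * Shell) := mul_nonneg (mul_nonneg ha hM0) (mul_nonneg hCF0 hShell0)
  have hQ0 : 0 ≤ tT * Sg := mul_nonneg htT hSg0
  -- bound the `ℝ≥0∞` right side by `ofReal` of the real bound
  have h1 : A * (((ENNReal.ofReal (Real.exp 1) * ENNReal.ofReal Kσ) + ENNReal.ofReal s) *
        ∫⁻ p : ℝ × ℝ, D p * ENNReal.ofReal ((1 + p.1 ^ 2)⁻¹ * (1 + p.2 ^ 2)⁻¹)) + T * ENNReal.ofReal Sg ≤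
      ENNReal.ofReal a * ((ENNReal.ofReal (Real.exp 1) * ENNReal.ofReal Kσ) + ENNReal.ofReal s) * (ENNReal.ofReal CF * ENNReal.ofReal Shell) +
        ENNReal.ofReal tT * ENNReal.ofReal Sg :=
    calc A * (((ENNReal.ofReal (Real.exp 1) * ENNReal.ofReal Kσ) + ENNReal.ofReal s) *
          ∫⁻ p : ℝ × ℝ, D p * ENNReal.ofReal ((1 + p.1 ^ 2)⁻¹ * (1 + p.2 ^ 2)⁻¹)) + T * ENNReal.ofReal Sg
        ≤ ENNReal.ofReal a * (((ENNReal.ofReal (Real.exp 1) * ENNReal.ofReal Kσ) + ENNReal.ofReal s) * (ENNReal.ofReal CF * ENNReal.ofReal Shell)) +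
          ENNReal.ofReal tT * ENNReal.ofReal Sg :=
          add_le_add (mul_le_mul' hA (mul_le_mul' (le_refl _) hDW)) (mul_le_mul' hT (le_refl _))
      _ = _ := by ring
  have e1 : ENNReal.ofReal (Kc * (a * (Real.exp 1 * Kσ + s) * (CF * Shell) + tT * Sg)) =
      ENNReal.ofReal Kc * (ENNReal.ofReal a * ((ENNReal.ofReal (Real.exp 1) * ENNReal.ofReal Kσ) + ENNReal.ofReal s) *
        (ENNReal.ofReal CF * ENNReal.ofReal Shell) + ENNReal.ofReal tT * ENNReal.ofReal Sg) := by
    rw [ENNReal.ofReal_mul hKc0, ENNReal.ofReal_add hP0 hQ0, ENNReal.ofReal_mul (mul_nonneg ha hM0), ENNReal.ofReal_mul ha,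
      ENNReal.ofReal_add (mul_nonneg (Real.exp_pos 1).le hKσ0) hs0.le, ENNReal.ofReal_mul (Real.exp_pos 1).le, ENNReal.ofReal_mul hCF0,
      ENNReal.ofReal_mul htT]
  have hlin : ∫⁻ p in {p : ℝ × GnoCoord L | p.1 ∈ Ioo (-s) s}, g p ∂μB ≤ ENNReal.ofReal (Kc * (a * (Real.exp 1 * Kσ + s) * (CF * Shell) + tT * Sg)) := by
    rw [e1]
    exact hγ.trans (mul_le_mul' (le_refl _) h1)
  -- (α)
  have hα := SigmaBall.setIntegral_le_of_lintegral_indicator_le (μ := μB) hGm hGS (f := fun q => Real.exp (-(b * Fh q)))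
    (fun q _ => (Real.exp_pos _).le) (mul_nonneg hKc0 (add_nonneg hP0 hQ0)) hlin
  simpa only using hα

end Summit.QuantumFields.YangMills.Theorems.SwapVirialDeficit.SectorLaplace

end
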